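import Summits.BirchSwinnertonDyer.BirchSwinnertonDyer.Theorems.BiquadraticEisensteinDescentHeegnerTwistCouplingInSupplySqrtTwoCornerSeven
import Summits.BirchSwinnertonDyer.BirchSwinnertonDyer.Theorems.BiquadraticEisensteinDescentHeegnerTwistCouplingInSupplySqrtTwoDualSeven
import Mathlib.FieldTheory.Finite.GaloisField
import HarnessLib

set_option linter.dupNamespace false -- `Summit.BirchSwinnertonDyer.BirchSwinnertonDyer.Theorems.…` (summit = sub)
set_option autoImplicit false

/-!
# Crux `HeegnerTwistCouplingInSupply` (stmt-BirchSwinnertonDyer-21381) — card `sqrt2-isogeny-heegner-pin`: the mod-16 law, CONVERSE direction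
# (`x⁴ − 4x² + 2` has a root modulo an odd prime `ℓ` only if `ℓ ≡ ±1 (mod 16)`), and the GENERAL pin-free rung for `W = B_p`, `p ≡ 5 (mod 8)`:
# every prime `ℓ ≡ 7 (mod 16)`, `ℓ < 6p`, `(p/ℓ) = +1` gives `K′ = ℚ(√−ℓ)` — modulo Burungale–Tian + Deuring–Hecke

Route `BiquadraticEisensteinDescent` (cell `pub/bsd-wall`, width seat `bsd-wall-cm-bed-w2` g12; `--supports` 21381, helper). `…SqrtTwoLaw`
(p651809) proved: `p ≡ 15 (16)` ⇒ `x⁴ − 4x² + 2` has a root mod `p`. Here the converse, so that the third cell `…SqrtTwoCellSeven` / the rungs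
`…SqrtTwoCornerSeven` (where rootlessness was supplied per rung by `decide`) hold for EVERY twisting prime `ℓ ≡ 7 (mod 16)`:

* ★ `mod_sixteen_of_root` — odd prime `ℓ`, `x⁴ − 4x² + 2 = 0` in `𝔽_ℓ` ⇒ `ℓ ≡ ±1 (mod 16)`. Proof in `𝔽_{ℓ²} = GaloisField ℓ 2`: the
  discriminant `x² − 4 ∈ 𝔽_ℓ` is a square there (`a^{(ℓ²−1)/2} = (a^{ℓ−1})^{(ℓ+1)/2} = 1`, `FiniteField.isSquare_iff`), so `Z² − xZ + 1` has roots
  `ζ, w` with `ζw = 1`, `ζ + w = x`; `ζ⁴ + w⁴ = x⁴ − 4x² + 2 = 0` gives `ζ⁸ = −1`, `orderOf ζ = 16`; Frobenius fixes the quadratic, so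
  `ζ^ℓ ∈ {ζ, w}`: `16 ∣ ℓ − 1` or `16 ∣ ℓ + 1`. `rootless_of_mod_sixteen` — the contrapositive (`ℓ ≢ ±1 (16)` ⇒ rootless).
* ★★ `cruxOnBpCornerPrimeTwist_of_two_facts` — for primes `p ≡ 5 (8)`, `p ≠ 5`, `ℓ ≡ 7 (16)`, `ℓ < 6p`, `(p/ℓ) = +1`: the conclusion of crux
  21381 for `W = B_p` with `K′ = ℚ(√−ℓ)` (`h(K′) < p` by the size lever `classNumber_lt_of_natAbs_discr_lt_six_mul`), modulo `hBT` + `hH` only;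
  ★★ `cruxOnBdualCornerPrimeTwist_of_two_facts` (appended) — the same for the dual member `W = B_{−2p}` (CELL-7′ of `…SqrtTwoDualSeven`).

HONEST FRAMING: rungs, not the class — covering ALL `p ≡ 5 (8)` this way needs a prime `ℓ ≡ 7 (16)`, `ℓ < 6p`, in the residue coset of `p`
(a least-prime-in-coset input, not in the tree); C⁺ untouched; crux 21381 NOT closed; BSD is not proved by any of this. THEOREMS ONLY;
supports stmt-BirchSwinnertonDyer-21381.
-/

noncomputable section

open scoped Classical

namespace Summit.BirchSwinnertonDyer.BirchSwinnertonDyer.Theorems.BiquadraticEisensteinDescentHeegnerTwistCouplingInSupplySqrtTwoLawConverse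

/-- **Converse of `…SqrtTwoLaw.twoPlusSqrtTwoIsSquare`.** If `x⁴ − 4x² + 2` has a root modulo an odd prime `ℓ` then `ℓ ≡ ±1 (mod 16)`:
in `𝔽_{ℓ²}` the quadratic `Z² − xZ + 1` has roots `ζ, ζ⁻¹` (every element of `𝔽_ℓ` is a square in `𝔽_{ℓ²}`), `ζ⁴ + ζ⁻⁴ = x⁴ − 4x² + 2 = 0`
gives `ζ⁸ = −1`, so `ζ` has order `16`; Frobenius permutes the two roots, hence `ζ^ℓ = ζ` (`16 ∣ ℓ − 1`) or `ζ^ℓ = ζ⁻¹` (`16 ∣ ℓ + 1`).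
[folklore] -/
theorem mod_sixteen_of_root {ℓ : ℕ} [hℓ : Fact ℓ.Prime] (hℓ2 : ℓ ≠ 2) {x : ZMod ℓ} (hx : x ^ 4 - 4 * x ^ 2 + 2 = 0) :
    ℓ % 16 = 1 ∨ ℓ % 16 = 15 := by
  classical
  haveI : Fintype (GaloisField ℓ 2) := Fintype.ofFinite _
  have hcard : Fintype.card (GaloisField ℓ 2) = ℓ ^ 2 := by
    rw [← Nat.card_eq_fintype_card]; exact GaloisField.card ℓ 2 two_ne_zero
  have hchar : ringChar (GaloisField ℓ 2) = ℓ := ringChar.eq (GaloisField ℓ 2) ℓ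
  have h2F : (2 : GaloisField ℓ 2) ≠ 0 := by
    intro h
    have h' : ((2 : ℕ) : GaloisField ℓ 2) = 0 := by exact_mod_cast h
    rw [CharP.cast_eq_zero_iff (GaloisField ℓ 2) ℓ] at h'
    exact hℓ2 ((Nat.prime_dvd_prime_iff_eq hℓ.out Nat.prime_two).mp h')
  obtain ⟨k, hk⟩ : ∃ k, ℓ = 2 * k + 1 := hℓ.out.odd_of_ne_two hℓ2
  set x' : GaloisField ℓ 2 := algebraMap (ZMod ℓ) (GaloisField ℓ 2) x with hx'
  have hx4 : x' ^ 4 - 4 * x' ^ 2 + 2 = 0 := by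
    have := congrArg (algebraMap (ZMod ℓ) (GaloisField ℓ 2)) hx
    rwa [map_add, map_sub, map_pow, map_mul, map_pow, map_ofNat, map_ofNat, map_zero] at this
  -- a square root `r` of the discriminant `x'² − 4 ∈ 𝔽_ℓ` inside `𝔽_{ℓ²}`
  obtain ⟨r, hr⟩ : IsSquare (x' ^ 2 - 4) := by
    by_cases hD : x' ^ 2 - 4 = 0
    · exact ⟨0, by rw [hD, mul_zero]⟩
    · rw [FiniteField.isSquare_iff (by rw [hchar]; exact hℓ2) hD, hcard]
      have hD' : x' ^ 2 - 4 = algebraMap (ZMod ℓ) (GaloisField ℓ 2) (x ^ 2 - 4) := by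
        rw [map_sub, map_pow, map_ofNat]
      have hd0 : x ^ 2 - 4 ≠ 0 := fun h => hD (by rw [hD', h, map_zero])
      have hpow : (x ^ 2 - 4) ^ (ℓ - 1) = 1 := ZMod.pow_card_sub_one_eq_one hd0
      have hexp : ℓ ^ 2 / 2 = (ℓ - 1) * (k + 1) := by
        have h1 : ℓ ^ 2 = 2 * (2 * (k * k) + 2 * k) + 1 := by rw [hk]; ring
        have h2 : (ℓ - 1) * (k + 1) = 2 * (k * k) + 2 * k := by rw [hk, Nat.add_sub_cancel]; ring
        rw [h1, h2]; omega
      rw [hexp, pow_mul, hD', ← map_pow, hpow, map_one, one_pow]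
  -- the roots `ζ, w` of `Z² − x'Z + 1`
  set ζ : GaloisField ℓ 2 := (x' + r) / 2 with hζ
  set w : GaloisField ℓ 2 := (x' - r) / 2 with hw
  have hζw : ζ * w = 1 := by
    rw [hζ, hw, div_mul_div_comm, div_eq_one_iff_eq (mul_ne_zero h2F h2F)]
    linear_combination hr
  have hsum : ζ + w = x' := by rw [hζ, hw]; field_simp; ring
  have hζ0 : ζ ≠ 0 := fun h => by rw [h, zero_mul] at hζw; exact zero_ne_one hζw
  -- `ζ⁴ + w⁴ = x'⁴ − 4x'² + 2 = 0`, so `ζ⁸ = −1`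
  have h44 : ζ ^ 4 + w ^ 4 = 0 := by
    have : (ζ + w) ^ 4 - 4 * (ζ + w) ^ 2 + 2 = ζ ^ 4 + w ^ 4 := by
      linear_combination (4 * ζ ^ 2 + 4 * w ^ 2 + 6 * ζ * w - 2) * hζw
    rw [← this, hsum]; exact hx4
  have h8 : ζ ^ 8 = -1 := by
    have : ζ ^ 8 + 1 = ζ ^ 4 * (ζ ^ 4 + w ^ 4) := by
      linear_combination (-(1 + ζ * w + ζ ^ 2 * w ^ 2 + ζ ^ 3 * w ^ 3)) * hζw
    rw [h44, mul_zero] at this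
    linear_combination this
  have h16 : ζ ^ 16 = 1 := by rw [show (16 : ℕ) = 8 * 2 by norm_num, pow_mul, h8]; norm_num
  have hord : orderOf ζ = 16 := by
    have h := orderOf_eq_prime_pow (p := 2) (n := 3) (x := ζ) (by
      rw [show (2 : ℕ) ^ 3 = 8 by norm_num, h8]
      intro h
      apply h2F
      linear_combination -h) (by rw [show (2 : ℕ) ^ (3 + 1) = 16 by norm_num]; exact h16)
    rw [h]; norm_num
  -- Frobenius permutes the roots of `Z² − x'Z + 1`
  have hquad : ζ ^ 2 - x' * ζ + 1 = 0 := by rw [← hsum]; linear_combination (-1) * hζw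
  have hx'ℓ : x' ^ ℓ = x' := by rw [hx', ← map_pow, ZMod.pow_card]
  have hfrob : (ζ ^ ℓ) ^ 2 - x' * ζ ^ ℓ + 1 = 0 := by
    have h := congrArg (fun y : GaloisField ℓ 2 => y ^ ℓ) hquad
    rw [zero_pow hℓ.out.ne_zero, add_pow_char, sub_pow_char, one_pow, mul_pow, hx'ℓ, ← pow_mul, mul_comm 2 ℓ, pow_mul] at h
    exact h
  have hroots : (ζ ^ ℓ - ζ) * (ζ ^ ℓ - w) = 0 := by
    have e : (ζ ^ ℓ - ζ) * (ζ ^ ℓ - w) = (ζ ^ ℓ) ^ 2 - x' * ζ ^ ℓ + 1 := by rw [← hsum]; linear_combination hζw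
    rw [e]; exact hfrob
  rcases mul_eq_zero.mp hroots with h | h
  · -- `ζ^ℓ = ζ`: `16 ∣ ℓ − 1`
    left
    have h1 : ζ ^ (ℓ - 1) = 1 := by
      have : ζ ^ (ℓ - 1) * ζ = 1 * ζ := by
        rw [← pow_succ, one_mul, show ℓ - 1 + 1 = ℓ by have := hℓ.out.one_lt; omega]
        exact sub_eq_zero.mp h
      exact mul_right_cancel₀ hζ0 this
    have hdvd : 16 ∣ ℓ - 1 := by rw [← hord]; exact orderOf_dvd_of_pow_eq_one h1
    omega
  · -- `ζ^ℓ = w = ζ⁻¹`: `16 ∣ ℓ + 1`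
    right
    have h1 : ζ ^ (ℓ + 1) = 1 := by rw [pow_succ, sub_eq_zero.mp h, mul_comm, hζw]
    have hdvd : 16 ∣ ℓ + 1 := by rw [← hord]; exact orderOf_dvd_of_pow_eq_one h1
    omega

/-- **`x⁴ − 4x² + 2` is rootless modulo every odd prime `ℓ ≢ ±1 (mod 16)`** — in particular for `ℓ ≡ 7 (mod 16)`, the twisting primes of the
third cell (`2 ± √2` are non-squares there). [folklore] -/
theorem rootless_of_mod_sixteen {ℓ : ℕ} (hℓ : ℓ.Prime) (hℓ2 : ℓ ≠ 2) (h1 : ℓ % 16 ≠ 1) (h15 : ℓ % 16 ≠ 15) :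
    ∀ x : ZMod ℓ, x ^ 4 - 4 * x ^ 2 + 2 ≠ 0 := by
  haveI : Fact ℓ.Prime := ⟨hℓ⟩
  intro x hx
  rcases mod_sixteen_of_root hℓ2 hx with h | h
  · exact h1 h
  · exact h15 h

open _root_.WeierstrassCurve Literature.NumberTheory.EllipticCurves
open Summit.BirchSwinnertonDyer.BirchSwinnertonDyer.Theorems.BiquadraticEisensteinDescentHeegnerTwistCouplingInSupplySqrtTwoCell (isElliptic_B)
open Summit.BirchSwinnertonDyer.BirchSwinnertonDyer.Theorems.BiquadraticEisensteinDescentHeegnerTwistCouplingInSupplySqrtTwoCellSeven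
  (selmerCorank_two_eq_zero)
open Summit.BirchSwinnertonDyer.BirchSwinnertonDyer.Theorems.BiquadraticEisensteinDescentHeegnerTwistCouplingInSupplySqrtTwoCorner
  (quadraticTwist_B eq_two_or_eq_of_prime_dvd_conductorNorm_B L_one_ne_zero_B_neg_of_selmerCorank)
open Summit.BirchSwinnertonDyer.BirchSwinnertonDyer.Theorems.BiquadraticEisensteinDescentHeegnerTwistCouplingInSupplyThreeSquaresPinCorner
  (classNumber_lt_of_natAbs_discr_lt_six_mul)

/-- ★★ **The general pin-free rung** (no table, no `decide`): for primes `p ≡ 5 (mod 8)`, `p ≠ 5`, and `ℓ ≡ 7 (mod 16)` with `ℓ < 6p` and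
`(p/ℓ) = +1`, the conclusion of crux `HeegnerTwistCouplingInSupply` holds for `W = B_p : y² = x³ + 4px² + 2p²x` with `K′ = ℚ(√−ℓ)`: imaginary
quadratic, `d = −ℓ`, `4 < |d|`, Heegner for `N(B_p)` (`2` splits as `−ℓ ≡ 1 (8)`; `(−ℓ/p) = (p/ℓ) = +1`), `L(B_p^{(−ℓ)}, 1) = L(B_{−pℓ}, 1) ≠ 0`
(third cell — `x⁴ − 4x² + 2` rootless mod `ℓ` by `rootless_of_mod_sixteen` — then Burungale–Tian + Deuring–Hecke), `h(K′) < p` (size lever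
`ℓ < 6p`), `p ∤ h(K′)`. [cite: BurungaleTian2026, Thm. 1.1] [cite: SilvermanAEC2009, Prop. X.4.9] [cite: Oesterle1988Gauss, II §3 Proposition p. 57 (27)] -/
theorem cruxOnBpCornerPrimeTwist_of_two_facts (hBT : burungaleTian_analyticRank_eq_zero_of_selmerCorank_eq_zero_of_hasCM)
    (hH : hasEntireLFunction_of_j_mem_maximalCMJInvariants) {p ℓ : ℕ} (hp : p.Prime) (hp8 : p % 8 = 5) (h5 : p ≠ 5)
    (hℓ : ℓ.Prime) (hℓ16 : ℓ % 16 = 7) (hℓp : ℓ < 6 * p) (hJ : jacobiSym (p : ℤ) ℓ = 1)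
    [(⟨0, 4 * (p : ℚ), 0, 2 * (p : ℚ) ^ 2, 0⟩ : WeierstrassCurve ℚ).IsElliptic] :
    ∃ (K : Type) (_ : Field K) (_ : NumberField K),
      IsImaginaryQuadratic K ∧ NumberField.discr K = -(ℓ : ℤ) ∧ 4 < (NumberField.discr K).natAbs ∧
      SatisfiesHeegnerHypothesis ((⟨0, 4 * (p : ℚ), 0, 2 * (p : ℚ) ^ 2, 0⟩ : WeierstrassCurve ℚ).conductorNorm ℤ) K ∧
      ((⟨0, 4 * (p : ℚ), 0, 2 * (p : ℚ) ^ 2, 0⟩ : WeierstrassCurve ℚ).quadraticTwist (NumberField.discr K : ℚ)).entireLFunction 1 ≠ 0 ∧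
      NumberField.classNumber K < p ∧ ¬ p ∣ NumberField.classNumber K := by
  haveI : Fact p.Prime := ⟨hp⟩
  haveI : Fact ℓ.Prime := ⟨hℓ⟩
  haveI : Fact ((-(ℓ : ℤ)) < 0) := ⟨by have := hℓ.pos; omega⟩
  have hp13 : 13 ≤ p := by omega
  have hpl : p ≠ ℓ := by rintro rfl; omega
  have hroot := rootless_of_mod_sixteen hℓ (by rintro rfl; omega) (by omega) (by omega)
  have hsf : Squarefree (-(ℓ : ℤ)).natAbs := by
    rw [Int.natAbs_neg, Int.natAbs_natCast]; exact hℓ.squarefree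
  have hD8 : (-(ℓ : ℤ)) % 8 = 1 := by omega
  obtain ⟨hK, hdK⟩ := isImaginaryQuadratic_and_discr_sqrtField_of_squarefree_natAbs (-(ℓ : ℤ)) (by omega) hsf
  have hJ' : jacobiSym (ℓ : ℤ) p = 1 := by
    rw [← jacobiSym.quadratic_reciprocity_one_mod_four (by omega) (Nat.odd_iff.mpr (by omega))]; exact hJ
  have hJneg : jacobiSym (-(ℓ : ℤ)) p = 1 := by
    rw [jacobiSym.neg _ (Nat.odd_iff.mpr (by omega)), ZMod.χ₄_nat_one_mod_four (by omega), hJ', one_mul]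
  have hp0 : ((p : ℤ) : ZMod ℓ) ≠ 0 := by
    rw [Ne, ZMod.intCast_zmod_eq_zero_iff_dvd, Int.natCast_dvd_natCast]
    exact fun h => hpl ((Nat.prime_dvd_prime_iff_eq hℓ hp).mp h).symm
  have hsq : IsSquare (p : ZMod ℓ) := by
    have h := (legendreSym.eq_one_iff ℓ hp0).mp (by rw [jacobiSym.legendreSym.to_jacobiSym]; exact hJ)
    simpa using h
  set m : ℤ := (p : ℤ) * (ℓ : ℤ) with hm
  have hm0 : 0 < m := by have := hp.pos; have := hℓ.pos; positivity
  have htw : (⟨0, 4 * (p : ℚ), 0, 2 * (p : ℚ) ^ 2, 0⟩ : WeierstrassCurve ℚ).quadraticTwist ((-(ℓ : ℤ) : ℤ) : ℚ) =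
      ⟨0, -4 * (m : ℚ), 0, 2 * (m : ℚ) ^ 2, 0⟩ := by
    rw [quadraticTwist_B, hm]; push_cast; ext <;> simp
  haveI := isElliptic_B hm0.ne'
  have hL := (L_one_ne_zero_B_neg_of_selmerCorank hBT hH hm0.ne'
    (selmerCorank_two_eq_zero hp hp8 hℓ (by omega) hroot hsq hm)).2
  have h4 : 4 < (NumberField.discr (sqrtField (-(ℓ : ℤ)))).natAbs := by
    rw [hdK, Int.natAbs_neg, Int.natAbs_natCast]; omega
  have hcl : NumberField.classNumber (sqrtField (-(ℓ : ℤ))) < p :=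
    classNumber_lt_of_natAbs_discr_lt_six_mul hK h4 (by omega) (by rw [hdK, Int.natAbs_neg, Int.natAbs_natCast]; exact hℓp)
  refine ⟨sqrtField (-(ℓ : ℤ)), inferInstance, inferInstance, hK, hdK, h4, ?_, ?_, hcl, fun hdvd =>
    absurd (Nat.le_of_dvd (NumberField.classNumber_pos _) hdvd) (not_le.mpr hcl)⟩
  · refine satisfiesHeegnerHypothesis_sqrtField_of_squarefree_natAbs _ hD8 hsf fun q hq hqN => ?_
    rcases eq_two_or_eq_of_prime_dvd_conductorNorm_B hp hq hqN with rfl | rfl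
    · exact Or.inl rfl
    · exact Or.inr hJneg
  · rw [hdK, htw]; exact hL

open Summit.BirchSwinnertonDyer.BirchSwinnertonDyer.Theorems.BiquadraticEisensteinDescentHeegnerTwistCouplingInSupplySqrtTwoDual
  (isElliptic_dual eq_two_or_eq_of_prime_dvd_conductorNorm_Bdual)
open Summit.BirchSwinnertonDyer.BirchSwinnertonDyer.Theorems.BiquadraticEisensteinDescentHeegnerTwistCouplingInSupplySqrtTwoDualFifteen
  (L_one_ne_zero_dual_of_selmerCorank)
open Summit.BirchSwinnertonDyer.BirchSwinnertonDyer.Theorems.BiquadraticEisensteinDescentHeegnerTwistCouplingInSupplySqrtTwoDualSeven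
  (selmerCorank_two_dual_eq_zero)

/-- ★★ **The general pin-free rung for the dual member `W = B_{−2p}`** (appended): primes `p ≡ 5 (mod 8)`, `p ≠ 5`, `ℓ ≡ 7 (mod 16)`, `ℓ < 6p`,
`(p/ℓ) = +1` ⇒ the conclusion of crux 21381 for `W = B_{−2p} : y² = x³ − 8px² + 8p²x` with `K′ = ℚ(√−ℓ)` (CELL-7′ of `…SqrtTwoDualSeven`, rootlessness
by `rootless_of_mod_sixteen`), modulo Burungale–Tian + Deuring–Hecke only. [cite: BurungaleTian2026, Thm. 1.1] [cite: SilvermanAEC2009, Prop. X.4.9]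
[cite: Oesterle1988Gauss, II §3 Proposition p. 57 (27)] -/
theorem cruxOnBdualCornerPrimeTwist_of_two_facts (hBT : burungaleTian_analyticRank_eq_zero_of_selmerCorank_eq_zero_of_hasCM)
    (hH : hasEntireLFunction_of_j_mem_maximalCMJInvariants) {p ℓ : ℕ} (hp : p.Prime) (hp8 : p % 8 = 5) (h5 : p ≠ 5)
    (hℓ : ℓ.Prime) (hℓ16 : ℓ % 16 = 7) (hℓp : ℓ < 6 * p) (hJ : jacobiSym (p : ℤ) ℓ = 1)
    [(⟨0, -8 * (p : ℚ), 0, 8 * (p : ℚ) ^ 2, 0⟩ : WeierstrassCurve ℚ).IsElliptic] :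
    ∃ (K : Type) (_ : Field K) (_ : NumberField K),
      IsImaginaryQuadratic K ∧ NumberField.discr K = -(ℓ : ℤ) ∧ 4 < (NumberField.discr K).natAbs ∧
      SatisfiesHeegnerHypothesis ((⟨0, -8 * (p : ℚ), 0, 8 * (p : ℚ) ^ 2, 0⟩ : WeierstrassCurve ℚ).conductorNorm ℤ) K ∧
      ((⟨0, -8 * (p : ℚ), 0, 8 * (p : ℚ) ^ 2, 0⟩ : WeierstrassCurve ℚ).quadraticTwist (NumberField.discr K : ℚ)).entireLFunction 1 ≠ 0 ∧
      NumberField.classNumber K < p ∧ ¬ p ∣ NumberField.classNumber K := by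
  haveI : Fact p.Prime := ⟨hp⟩
  haveI : Fact ℓ.Prime := ⟨hℓ⟩
  haveI : Fact ((-(ℓ : ℤ)) < 0) := ⟨by have := hℓ.pos; omega⟩
  have hp13 : 13 ≤ p := by omega
  have hpl : p ≠ ℓ := by rintro rfl; omega
  have hroot := rootless_of_mod_sixteen hℓ (by rintro rfl; omega) (by omega) (by omega)
  have hsf : Squarefree (-(ℓ : ℤ)).natAbs := by
    rw [Int.natAbs_neg, Int.natAbs_natCast]; exact hℓ.squarefree
  have hD8 : (-(ℓ : ℤ)) % 8 = 1 := by omega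
  obtain ⟨hK, hdK⟩ := isImaginaryQuadratic_and_discr_sqrtField_of_squarefree_natAbs (-(ℓ : ℤ)) (by omega) hsf
  have hJ' : jacobiSym (ℓ : ℤ) p = 1 := by
    rw [← jacobiSym.quadratic_reciprocity_one_mod_four (by omega) (Nat.odd_iff.mpr (by omega))]; exact hJ
  have hJneg : jacobiSym (-(ℓ : ℤ)) p = 1 := by
    rw [jacobiSym.neg _ (Nat.odd_iff.mpr (by omega)), ZMod.χ₄_nat_one_mod_four (by omega), hJ', one_mul]
  have hp0 : ((p : ℤ) : ZMod ℓ) ≠ 0 := by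
    rw [Ne, ZMod.intCast_zmod_eq_zero_iff_dvd, Int.natCast_dvd_natCast]
    exact fun h => hpl ((Nat.prime_dvd_prime_iff_eq hℓ hp).mp h).symm
  have hsq : IsSquare (p : ZMod ℓ) := by
    have h := (legendreSym.eq_one_iff ℓ hp0).mp (by rw [jacobiSym.legendreSym.to_jacobiSym]; exact hJ)
    simpa using h
  set m : ℤ := (p : ℤ) * (ℓ : ℤ) with hm
  have hm0 : 0 < m := by have := hp.pos; have := hℓ.pos; positivity
  have htw : (⟨0, -8 * (p : ℚ), 0, 8 * (p : ℚ) ^ 2, 0⟩ : WeierstrassCurve ℚ).quadraticTwist ((-(ℓ : ℤ) : ℤ) : ℚ) =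
      ⟨0, 8 * (m : ℚ), 0, 8 * (m : ℚ) ^ 2, 0⟩ := by
    rw [quadraticTwist_mk, hm]; push_cast; ext <;> simp <;> ring
  haveI := isElliptic_dual hm0.ne'
  have hL := L_one_ne_zero_dual_of_selmerCorank hBT hH hm0.ne' (selmerCorank_two_dual_eq_zero hp hp8 hℓ (by omega) hroot hsq hm)
  have h4 : 4 < (NumberField.discr (sqrtField (-(ℓ : ℤ)))).natAbs := by
    rw [hdK, Int.natAbs_neg, Int.natAbs_natCast]; omega
  have hcl : NumberField.classNumber (sqrtField (-(ℓ : ℤ))) < p :=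
    classNumber_lt_of_natAbs_discr_lt_six_mul hK h4 (by omega) (by rw [hdK, Int.natAbs_neg, Int.natAbs_natCast]; exact hℓp)
  refine ⟨sqrtField (-(ℓ : ℤ)), inferInstance, inferInstance, hK, hdK, h4, ?_, ?_, hcl, fun hdvd =>
    absurd (Nat.le_of_dvd (NumberField.classNumber_pos _) hdvd) (not_le.mpr hcl)⟩
  · refine satisfiesHeegnerHypothesis_sqrtField_of_squarefree_natAbs _ hD8 hsf fun q hq hqN => ?_
    rcases eq_two_or_eq_of_prime_dvd_conductorNorm_Bdual hp hq hqN with rfl | rfl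
    · exact Or.inl rfl
    · exact Or.inr hJneg
  · rw [hdK, htw]; exact hL

end Summit.BirchSwinnertonDyer.BirchSwinnertonDyer.Theorems.BiquadraticEisensteinDescentHeegnerTwistCouplingInSupplySqrtTwoLawConverse

end
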